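import Summits.AnomalousDissipation.AnomalousDissipation.Theses.SymmetricOrLoud

/-!
# Glue `BoundedZMLaws → StreamwiseSymmetryUnbounded → NoPlanarTypeRelaxation → AsymmetricBoundedLaws` (SymmetricOrLoud)

Sorry-free proof of the GLUE item `SymmetricOrLoud.AsymmetricBoundedLawsGlue` (stmt-AnomalousDissipation-27449).
Mechanism: `NoPlanarTypeRelaxation` turns the bounded zero-mean laws into bounded laws that are NOT almost surely of planar
symmetry type; along the TAIL `j ≥ j₀` where `ν j ≤ ν₀(E₀)` (`ν → 0`), `StreamwiseSymmetryUnbounded` forbids every non-planar-type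
(streamwise-closing) symmetry of a path of mean energy `≤ E₀`; hence an almost-sure symmetry would be almost surely of planar type —
contradiction.  The witness is the shifted sequence `j ↦ ν (j + j₀)`.  No facts are asserted.
Source: decomp-ad cell, route-AnomalousDissipation-SymmetricOrLoud (lens-4 g3/g4 split; docstring proof); landed by the cell's prover seat.
-/

set_option linter.dupNamespace false

open Filter Topology MeasureTheory

namespace Summit.AnomalousDissipation.AnomalousDissipation.Theorems.AsymmetricBoundedLawsGlue

open Summit.AnomalousDissipation.AnomalousDissipation.Theses.SymmetricOrLoud

/-- The GLUE item `SymmetricOrLoud.AsymmetricBoundedLawsGlue` (stmt-AnomalousDissipation-27449) holds. [folklore] -/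
theorem asymmetricBoundedLawsGlue_holds : AsymmetricBoundedLawsGlue := by
  intro hB hT hN
  obtain ⟨E₀, ν, hν, hν1, hν0, hlaw⟩ := hN hB
  obtain ⟨ν₀, hν₀, hTE⟩ := hT E₀
  have hev : ∀ᶠ j in atTop, ν j ≤ ν₀ := hν0.eventually (Iic_mem_nhds hν₀)
  obtain ⟨j₀, hj₀⟩ := Filter.eventually_atTop.1 hev
  refine ⟨E₀, fun j => ν (j + j₀), fun j => hν _, fun j => hν1 _, hν0.comp (tendsto_add_atTop_nat j₀), fun j => ?_⟩
  obtain ⟨Ω, mΩ, sΩ, P, hP, S, traj, hS, hshift, hmeas, hLH, hzm, hE, hnot⟩ := hlaw (j + j₀)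
  refine ⟨Ω, mΩ, sΩ, P, hP, S, traj, hS, hshift, hmeas, hLH, hzm, hE, ?_⟩
  intro hae
  apply hnot
  filter_upwards [hae] with ω hω
  obtain ⟨v, hv0, hfinv, htinv⟩ := hω
  refine ⟨v, hv0, ?_, hfinv, htinv⟩
  by_contra hc
  push Not at hc
  have hlt := hTE (ν (j + j₀)) (hν _) (hj₀ _ (Nat.le_add_left j₀ j)) (traj ω 0) (traj ω) (hLH ω) (hzm ω) v
    (fun c hsum => by
      by_contra h0
      exact hc c h0 hsum) htinv
  exact lt_irrefl _ (hlt.trans_le (hE ω))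

end Summit.AnomalousDissipation.AnomalousDissipation.Theorems.AsymmetricBoundedLawsGlue
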